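import Literature.AlgebraicGeometry.Motives.VarietiesProperProofs
import HarnessLib

/-!
# Discharged facts: smooth projective varieties are quasi-compact over `k`, with compact underlying space (Hartshorne II.4.9)

`Literature.AlgebraicGeometry.Motives.Varieties` records as named facts
(`Literature.AlgebraicGeometry.Motives.IsSmoothProjective.quasiCompact : Prop` and
`Literature.AlgebraicGeometry.Motives.IsSmoothProjective.compactSpace : Prop`) that the structure
morphism `X → Spec k` of a smooth projective variety `X` over a field `k` is quasi-compact, and that
the underlying topological space of `X` is compact. This file proves both
(`Literature.AlgebraicGeometry.Motives.IsSmoothProjective.quasiCompact_holds`,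
`Literature.AlgebraicGeometry.Motives.IsSmoothProjective.compactSpace_holds`), so users holding
`(h : IsSmoothProjective.quasiCompact)` / `(h : IsSmoothProjective.compactSpace)` can discharge the
hypothesis. Only the field `IsSmoothProjective.isProjectiveOver` (a closed `k`-immersion `X ↪ ℙᴺ_k`)
is used: the general statements are `Literature.AlgebraicGeometry.Motives.IsProjectiveOver.quasiCompact`
and `Literature.AlgebraicGeometry.Motives.IsProjectiveOver.compactSpace`.

## Proof

Hartshorne, *Algebraic Geometry*, II Thm. 4.9 (p. 103): "A projective morphism of noetherian schemes
is proper"; proper means separated, of finite type and universally closed (II §4, Definition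
p. 100), and finite type = locally of finite type + quasi-compact (II Ex. 3.3(a)). In the printed
proof the quasi-compactness is the remark that `ℙⁿ` is the union of the `n + 1` open affines
`D₊(xᵢ)` (II Prop. 2.5), composed with the closed immersion `X ↪ ℙᴺ` (II Cor. 4.8(a),(b)).

In Lean we feed the already discharged properness
(`Literature.AlgebraicGeometry.Motives.IsProjectiveOver.isProper`, module
`Literature.AlgebraicGeometry.Motives.VarietiesProperProofs`, same theorem of Hartshorne) into
Mathlib's instance "universally closed ⇒ quasi-compact"
(`Mathlib.AlgebraicGeometry.Morphisms.UniversallyClosed`, Stacks 04XU); and a scheme quasi-compact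
over the quasi-compact space `Spec k` is compact (Mathlib
`AlgebraicGeometry.QuasiCompact.compactSpace_of_compactSpace`; Hartshorne II Ex. 2.13(b), Ex. 3.2).
These are exactly the interim proofs preserved as comments next to the two facts in `Varieties`.

## References

* R. Hartshorne, *Algebraic Geometry*, GTM 52, Springer (1977), doi:10.1007/978-1-4757-3849-0:
  Ch. II §4, Definition of proper (p. 100) and of projective morphisms (p. 103), Thm. 4.9 (p. 103),
  Cor. 4.8(a),(b) (p. 102); Ch. II Prop. 2.5 (p. 76); Ch. II Ex. 2.13(b) (p. 80), Ex. 3.2 and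
  Ex. 3.3(a) (p. 91). [Hartshorne1977]
* The Stacks project, Tags 01WC (projective ⇒ proper), 04XU (universally closed ⇒ quasi-compact).
  [StacksProject]
-/

universe u

open CategoryTheory AlgebraicGeometry

namespace Literature.AlgebraicGeometry.Motives

section Projective

variable {k : Type u} [Field k] {n : ℕ} {X : SchemeOver k}

/-- **Hartshorne II Thm. 4.9**, quasi-compactness: a projective `k`-scheme is quasi-compact over `k`
(`X ↪ ℙᴺ_k` is a closed immersion, `ℙᴺ_k = ⋃ᵢ D₊(xᵢ)` is a finite union of affine opens; here
obtained from properness, `Literature.AlgebraicGeometry.Motives.IsProjectiveOver.isProper`, since a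
universally closed morphism is quasi-compact).
[cite: Hartshorne1977, Ch. II Thm. 4.9 (p. 103) with Definition of proper (p. 100) and Ex. 3.3(a) (p. 91)] -/
theorem IsProjectiveOver.quasiCompact (h : IsProjectiveOver X) : QuasiCompact X.hom :=
  haveI := h.isProper
  inferInstance

/-- A projective `k`-scheme has (quasi-)compact underlying topological space: it is quasi-compact
over `Spec k`, whose underlying space is quasi-compact (Hartshorne II Ex. 2.13(b), Ex. 3.2 and
Thm. 4.9). [cite: Hartshorne1977, Ch. II Thm. 4.9 (p. 103) with Ex. 2.13(b) (p. 80) and Ex. 3.2 (p. 91)] -/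
theorem IsProjectiveOver.compactSpace (h : IsProjectiveOver X) : CompactSpace X.left :=
  haveI := h.quasiCompact
  QuasiCompact.compactSpace_of_compactSpace X.hom

/-- Discharge of the named fact `Literature.AlgebraicGeometry.Motives.IsSmoothProjective.quasiCompact`:
the structure morphism `X → Spec k` of a smooth projective variety over a field `k` is quasi-compact,
because `X` is projective over `k` (`Literature.AlgebraicGeometry.Motives.IsProjectiveOver.quasiCompact`,
Hartshorne II Thm. 4.9: projective ⇒ proper ⇒ of finite type ⇒ quasi-compact).
[cite: Hartshorne1977, Ch. II Thm. 4.9 (p. 103)] -/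
theorem IsSmoothProjective.quasiCompact_holds : IsSmoothProjective.quasiCompact (n := n) (X := X) :=
  fun h => h.isProjectiveOver.quasiCompact

/-- Discharge of the named fact `Literature.AlgebraicGeometry.Motives.IsSmoothProjective.compactSpace`:
the underlying space of a smooth projective variety over a field `k` is compact
(`Literature.AlgebraicGeometry.Motives.IsProjectiveOver.compactSpace`, Hartshorne II Thm. 4.9 with
Ex. 2.13(b)). [cite: Hartshorne1977, Ch. II Thm. 4.9 (p. 103) and Ex. 2.13(b) (p. 80)] -/
theorem IsSmoothProjective.compactSpace_holds : IsSmoothProjective.compactSpace (n := n) (X := X) :=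
  fun h => h.isProjectiveOver.compactSpace

end Projective

end Literature.AlgebraicGeometry.Motives
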